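import Literature.NumberTheory.LFunctions.NoRealZeroCertificateReplayExcept
import Literature.NumberTheory.LFunctions.NoRealZeroSmallModuliII
import Literature.Barriers.RiemannHypothesis.EpsteinZetaRealZerosSmallK163
import HarnessLib

/-!
# Kernel replay of the Lu–Zaman–Zhao certificates: the LIGHT/HEAVY split with the deep rows settled directly

Topic `Literature/NumberTheory/LFunctions`. Glue for the two-layer plan of the kernel replay of
Lu–Zaman–Zhao's Table-1 certificates (arXiv:2602.03626, §2.1–§3) over the range `(23, 4·10⁵]`
(route `LZZCertificateReplay` of the `parity-realchar` cell): the LIGHT layer proves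
`CertifiedRange (1/5) 23 Q L` — every fundamental discriminant of the range outside an explicit list
`L` (the "heavy" discriminants, whose certificates need primes beyond `2^15`) carries a certificate —
and the HEAVY layer proves `CertifiedAt (1/5) D` for the members of `L`, EXCEPT those settled by
mathematics in the tree, which need no certificate at all:

* conductors `≤ 52`, both parities: `noRealZeroUpTo_fiftyTwo` (Fekete–Pólya positivity,
  `NoRealZeroSmallModuliII.lean`);
* odd characters of conductor `≤ 163`: the Epstein class sum,
  `Literature.Barriers.RiemannHypothesis.LFunction_ne_zero_of_odd_quadratic_of_le_onehundredsixtythree`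
  (`EpsteinZetaRealZerosSmallK163.lean`).

These are exactly the DEEPEST rows of the certificate table (`D = −163` needs the primes up to
`3.4·10⁷`, `24` up to `8.2·10⁶`, `29`, `28`, `−67`, `−43`, `33`, `37`, … up to `2.3·10⁶`–`6.4·10⁶`), so
after the split the heavy layer's deepest certificate needs primes up to `5.9·10⁶` only.

* `direct D` — the Boolean test "`D` is settled directly": `3 ≤ |D| ≤ 52`, or `D < 0` and
  `5 ≤ |D| ≤ 163`;
* `noRealZeroOddAt_of_le_onehundredsixtythree` — feeder: the odd characters of all moduli
  `4 < q ≤ 163` (Epstein);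
* **`noExceptionalZeroUpTo_of_light_heavy`** — from `theorem21` (the printed Theorem 2.1), a light layer
  `CertifiedRange (1/5) 23 Q L` and a heavy layer `∀ D ∈ L, direct D = false → CertifiedAt (1/5) D`,
  conclude `NoExceptionalZeroUpTo Q (1/5)`.

Definitions (`direct`) and theorems only; nothing is evaluated; standard axioms.

## References

* W. Lu, A. Zaman, K. Zhao, *Dirichlet L-functions of quadratic characters have no exceptional
  zeros for moduli up to 10¹⁰*, Math. Comp. (2026), arXiv:2602.03626, §2.1–§3. [LuZamanZhao2026]
* P. T. Bateman, E. Grosswald, *On Epstein's zeta function*, Acta Arith. 9 (1964) 365–373,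
  Theorem 3. [BatemanGrosswald1964]
* H. L. Montgomery, R. C. Vaughan, *Multiplicative Number Theory I*, CUP 2007, §11.2.
  [MontgomeryVaughan2007]
-/

noncomputable section

open Complex Finset

namespace Literature.NumberTheory.LFunctions
namespace LuZamanZhao2026
namespace Replay

open Literature.Barriers.RiemannHypothesis

/-- **The directly settled discriminants**: `3 ≤ |D| ≤ 52` (all characters of these conductors,
`noRealZeroUpTo_fiftyTwo`) or `D < 0` with `5 ≤ |D| ≤ 163` (odd characters, Epstein class sum).
[cite: LuZamanZhao2026, §3] -/
def direct (D : ℤ) : Bool :=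
  (decide (3 ≤ D.natAbs) && decide (D.natAbs ≤ 52)) ||
    (decide (D < 0) && decide (5 ≤ D.natAbs) && decide (D.natAbs ≤ 163))

/-- What `direct D = true` says. [cite: LuZamanZhao2026, §3] -/
theorem direct_eq_true_iff (D : ℤ) :
    direct D = true ↔ (3 ≤ D.natAbs ∧ D.natAbs ≤ 52) ∨ (D < 0 ∧ 5 ≤ D.natAbs ∧ D.natAbs ≤ 163) := by
  unfold direct
  simp only [Bool.or_eq_true, Bool.and_eq_true, decide_eq_true_eq, and_assoc]

/-- **Feeder (Epstein class sum, `k ≤ 32/5`)**: the odd characters of all moduli `4 < q ≤ 163` have no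
real zero in `(0, 1)`. [cite: BatemanGrosswald1964, Theorem 3] -/
theorem noRealZeroOddAt_of_le_onehundredsixtythree {M : List ℕ} (hM : ∀ q ∈ M, 4 < q ∧ q ≤ 163) :
    NoRealZeroOddAt M := by
  intro q _ hq χ hquad hprim hodd σ hσ0 hσ1
  obtain ⟨h4, h163⟩ := hM q hq
  exact LFunction_ne_zero_of_odd_quadratic_of_le_onehundredsixtythree h4 h163 hprim hquad hodd hσ0 hσ1

/-- The odd characters of ALL conductors `3 ≤ q ≤ 163` are settled (`q ≤ 52` by the kernel base,
`5 ≤ q ≤ 163` by Epstein). [cite: BatemanGrosswald1964, Theorem 3] -/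
theorem noRealZeroOddAt_range_onehundredsixtythree : NoRealZeroOddAt (List.range' 3 50 ++ List.range' 53 111) := by
  refine (noRealZeroUpTo_fiftyTwo.oddAt fun q hq => ?_).append
    (noRealZeroOddAt_of_le_onehundredsixtythree fun q hq => ?_)
  · rw [List.mem_range'] at hq
    obtain ⟨i, hi, rfl⟩ := hq
    omega
  · rw [List.mem_range'] at hq
    obtain ⟨i, hi, rfl⟩ := hq
    omega

/-- The even characters of all conductors `3 ≤ q ≤ 52` are settled (kernel base). [cite: MontgomeryVaughan2007, §11.2.1 Exercise 7] -/
theorem noRealZeroEvenAt_range_fiftyTwo : NoRealZeroEvenAt (List.range' 3 50) := by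
  refine noRealZeroUpTo_fiftyTwo.evenAt fun q hq => ?_
  rw [List.mem_range'] at hq
  obtain ⟨i, hi, rfl⟩ := hq
  omega

/-- **The LIGHT/HEAVY glue.** Assume Lu–Zaman–Zhao's Theorem 2.1 (`theorem21`, as printed), a light
layer `CertifiedRange (1/5) 23 Q L` (every fundamental `23 < |D| ≤ Q` outside `L` is certified) and a
heavy layer certifying every `D ∈ L` that is NOT settled directly (`direct D = false`). Then
`NoExceptionalZeroUpTo Q (1/5)`: no primitive quadratic `L(s, χ)` of modulus `3 ≤ q ≤ Q` vanishes on
`[1 − 1/(5 log q), 1] ∩ (0, 1]`. (Base `noExceptionalZeroUpTo_fiftyTwo`; the directly settled members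
of `L` go through `noExceptionalZeroUpTo_of_certifiedRange_except` with the odd conductors `≤ 163`
and the even conductors `≤ 52`.) [cite: LuZamanZhao2026, §2.1–§3] -/
theorem noExceptionalZeroUpTo_of_light_heavy (h21 : theorem21) {Q : ℕ} {L : List ℤ}
    (hl : CertifiedRange (1 / 5) 23 Q L) (hh : ∀ D ∈ L, direct D = false → CertifiedAt (1 / 5) D) :
    NoExceptionalZeroUpTo Q (1 / 5) := by
  classical
  by_cases hQ : Q ≤ 52
  · exact (noExceptionalZeroUpTo_fiftyTwo (1 / 5)).anti_level hQ
  have hQ' : 52 ≤ Q := by omega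
  -- keep only the directly settled exceptions
  set Y : List ℤ := L.filter fun D => direct D with hY
  have hlY : CertifiedRange (1 / 5) 23 Q Y := by
    refine hl.of_except fun D hD hDY => hh D hD ?_
    -- `D ∉ Y` means `direct D = false`
    cases h : direct D
    · rfl
    · exact absurd (List.mem_filter.2 ⟨hD, by simpa using h⟩) hDY
  have hlY' : CertifiedRange (1 / 5) 52 Q Y := hlY.mono (by norm_num) le_rfl
  refine noExceptionalZeroUpTo_of_certifiedRange_except h21 (by norm_num) (noExceptionalZeroUpTo_fiftyTwo _)
    hlY' noRealZeroOddAt_range_onehundredsixtythree noRealZeroEvenAt_range_fiftyTwo ?_ ?_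
  · intro D hD hD0
    have hd : direct D = true := by
      have := (List.mem_filter.1 hD).2
      simpa using this
    rw [direct_eq_true_iff] at hd
    rw [List.mem_append, List.mem_range', List.mem_range']
    rcases hd with ⟨h3, h52⟩ | ⟨-, h5, h163⟩
    · exact Or.inl ⟨D.natAbs - 3, by omega, by omega⟩
    · by_cases h52 : D.natAbs ≤ 52
      · exact Or.inl ⟨D.natAbs - 3, by omega, by omega⟩
      · exact Or.inr ⟨D.natAbs - 53, by omega, by omega⟩
  · intro D hD hD0
    have hd : direct D = true := by
      have := (List.mem_filter.1 hD).2
      simpa using this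
    rw [direct_eq_true_iff] at hd
    rw [List.mem_range']
    rcases hd with ⟨h3, h52⟩ | ⟨hneg, -, -⟩
    · exact ⟨D.natAbs - 3, by omega, by omega⟩
    · exact absurd hneg (not_lt.2 hD0.le)

end Replay
end LuZamanZhao2026
end Literature.NumberTheory.LFunctions

end
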